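import Literature.AlgebraicGeometry.HodgeTheory.RealMultiplicationDivisorClasses
import Literature.AlgebraicGeometry.HodgeTheory.HodgeEndomorphismsHOneOfRiemann
import Literature.AlgebraicGeometry.HodgeTheory.AbelianVarietyHodgeHomFullness
import HarnessLib

/-!
# The pairing classes `b'_k 0 ⌣ b'_{k'} 1 - b'_k 1 ⌣ b'_{k'} 0` of two GLUED blocks of `H¹(A) ⊗ ℂ` in the same class are combinations of rational `(1,1)`-classes; crossed classes of two slots at blocks of the same class lie in `D¹ ⊗ ℂ`; classwise-invariant coefficient functions evaluate into `D• ⊗ ℂ` (Hazama 1983 §3, Murty 1988 Thm. 2 with `m = 1` — the invariant-theory half, degree two and gluing)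

Family `hodge`, layer `Literature/AlgebraicGeometry/HodgeTheory`. Research context: cell `pub-hodge-ring2`
(HONEST FRAMING: research route conditional on HC_CM; not a corollary; Q11.4-sentence-2 already refuted in
dim ≥ 3), Literature lane, programme R6 (V. K. Murty 1988 Thm. 2, `m = 1`, fact-free), the CYCLE side — the
analogue of `RealMultiplicationDivisorClasses` (programme R2, colour = place) for blocks GLUED into classes
(colour = class). UNCONDITIONAL modulo the tree-light Betti hypotheses `hHD`, `hI`; theorems only; no named
fact (D-0026); no step towards a summit statement.

SETTING. `A` a complex abelian variety, `H = H¹(A(ℂ); ℚ)` with its weight-one Hodge structure, `ψ` a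
polarization, `H ⊗ ℂ = ⊕_{k ∈ ι} T_k` ANY internal decomposition into two-dimensional blocks with bases
`b'_k = (b'_k 0 ∈ H^{1,0}, b'_k 1 ∈ H^{0,1})` and a class map `cls : ι → ι` such that (the output of
`TotallyRealMaxSubfieldHodgeLieAlgebra.exists_glued_adapted_blockBasis_of_isMurtyTypeWith_one` at `𝔤 = Lie Hg`):
(`hreach`) for every `k₀` and every trace-free `N` the operator `N` placed (in the bases `b'`) on the blocks of
the class of `k₀` lies in `Lie Hg ⊗ ℂ`; (`hglue`) every `X ∈ Lie Hg` has equal blocks at `k, k'` whenever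
`cls k = cls k'`. In programme R2 (`End⁰(A)` a totally real field of degree `dim A`) the blocks are pairwise
`ψ_ℂ`-orthogonal; here they are NOT (the polarization need not be adapted to `K`), and the Casimir computation
of `RealMultiplicationDivisorClasses` is replaced by its glued form (§1).

MAIN RESULTS (all proved).
* §1 (generic linear algebra, any field) `GluedCasimir.isUnit_gram`, `GluedCasimir.sum_dual_eq_sum_blocks`,
  `GluedCasimir.pairing_eq_sum_gram_smul`: for a non-degenerate form `Ψ` with `Ψ(b_k 0, b_{k'} 0) =
  Ψ(b_k 1, b_{k'} 1) = 0`, `Φ(k,k') = Ψ(b_k 0, b_{k'} 1)` symmetric and `Ψ(b_k 1, b_{k'} 0) = -Φ(k', k)`, the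
  GRAM MATRIX `Φ` is invertible, the Casimir contraction of an operator `Y` is
  `∑_{k,k''} Φ⁻¹(k,k'') (β(Y b_{k''} 0, b_k 1) - β(Y b_{k''} 1, b_k 0))`, and the pairing
  `β(b_{k₁} 0, b_{k₃} 1) - β(b_{k₁} 1, b_{k₃} 0) = ∑_{k₂} Φ(k₂,k₃) · Casimir(u_{k₁ k₂})` with `u_{k₁ k₂}` the
  elementary intertwiner `b_{k₂} r ↦ b_{k₁} r` (`RealPlaces.intertwiner _ _ k₁ k₂ 1`).
* §2 `casimirClass_mem_span_rational_oneOne_of_mem_span_endAlg` (the `ψ`-Casimir class `Λ(u)` of every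
  `u ∈ End_Hdg(H¹) ⊗ ℂ` is a combination of RATIONAL `(1,1)`-classes — rational for `u = a ⊗ 1`, of type `(1,1)`
  by the glued block formula in ADAPTED bases, WITHOUT self-adjointness of `End_Hdg`),
  `intertwiner_one_mem_span_endAlg` (the elementary intertwiner between two blocks of the same class lies in
  `End_Hdg ⊗ ℂ`), `pairing_mem_span_rational_oneOne` (`b'_{k₁} 0 ⌣ b'_{k₃} 1 - b'_{k₁} 1 ⌣ b'_{k₃} 0 ∈ B¹(A) ⊗ ℂ`
  for `cls k₁ = cls k₃`), `theta_mem_span_rational_oneOne_of_glued` (`b'_k 0 ⌣ b'_k 1 ∈ B¹(A) ⊗ ℂ`).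
* §3 `gluedLetters_cross_mem_span_rational_oneOne` (the crossed class of two slots at two blocks OF THE SAME
  CLASS lies in `D¹(B) ⊗ ℂ`: transport the second block to the first by the intertwiner, a combination of
  `(F^* ⊗ 1)`, `F ∈ End(A)`, i.e. of twisted slots `g_{j'} ≫ F`, then the tree's same-block lemma
  `rmLetters_cross_mem_span_rational_oneOne`), `sum_pairingTensor_smul_gluedLetters_mem`,
  `wordEval_gluedLetters_mem_divisorClassesSpan_of_classwise` (a coefficient function killed, slice by slice,
  by `E₀₁` and `h` placed at the positions of each CLASS evaluates into `Dᵖ(B) ⊗ ℂ`: the colourwise first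
  fundamental theorem `mem_span_pairingTensor_of_colourwise` with colour = class).

## References

* [Hazama1983] F. Hazama, Tôhoku Math. J. 35 (1983) 303–308, Thm. (1.1), §3 pp. 305–306 (`p = 1`: the
  degree-two invariants; «the i-th component acts on `V_i ⊕ ⋯ ⊕ V_i` diagonally»).
  [cite: Hazama1983, Thm. (1.1) and §3 (pp. 305–306)]
* [Murty1988] V. Kumar Murty, Proc. AMS 104 (1988) 61–68, Thm. 2 (p. 67). [cite: Murty1988, Thm. 2 (p. 67)]
* [Ribet1983] K. A. Ribet, Amer. J. Math. 105 (1983), Thm. 0–1. [cite: Ribet1983, Thm. 0–1]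
* [GoodmanWallachGTM255] R. Goodman, N. R. Wallach, GTM 255 (2009), §4.1.1, Thm. 5.3.3.
  [cite: GoodmanWallachGTM255, §4.1.1 and Thm. 5.3.3]
* [Gordon1997] B. B. Gordon, arXiv:alg-geom/9709030, §3. [cite: Gordon1997, §3]
* [DeligneMilne1982Tannakian] P. Deligne, J. S. Milne, LNM 900 (1982), §6 Thm. 6.20. [cite: DeligneMilne1982Tannakian, §6 Thm. 6.20]
* [VoisinHodgeI2002] C. Voisin, *Hodge Theory I* (2002), §7.1.1–7.1.2, §11.3.1. [cite: VoisinHodgeI2002, §7.1.2]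
-/

noncomputable section

open scoped TensorProduct
open CategoryTheory Module

namespace Literature.AlgebraicGeometry.HodgeTheory

open Literature.AlgebraicTopology.SingularHomology
open Literature.AlgebraicGeometry.Motives (IsSmoothProjective AbelianVariety bettiCohomology
  ofRatClassBaseChange ofRatClassBaseChange_tmul HodgeTensorFacts)
open Literature.AlgebraicGeometry.Motives.HodgeStructure
open Literature.AlgebraicGeometry.ComplexMultiplication
open Literature.Barriers.HodgeConjecture
open Literature.RepresentationTheory.GeneralLinear
open Literature.NumberTheory.DiophantineGeometry

/-! ### §1 The glued Casimir computation (generic linear algebra) -/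

section Generic

variable {K : Type*} [Field K] {W : Type*} [AddCommGroup W] [Module K W] {P : Type*} [AddCommGroup P]
  [Module K P]
variable {ι : Type*} [Fintype ι] [DecidableEq ι] {T : ι → Submodule K W}

omit [Fintype ι] [DecidableEq ι] in
/-- Coordinates of an element of one block along its basis. [folklore] -/
private theorem GluedCasimir.eq_sum_repr (b : ∀ i, Module.Basis (Fin 2) K (T i)) {k : ι} {x : W}
    (hx : x ∈ T k) : x = ∑ c, (b k).repr ⟨x, hx⟩ c • (b k c : W) := by
  conv_lhs => rw [show x = ((⟨x, hx⟩ : T k) : W) from rfl, ← (b k).sum_repr ⟨x, hx⟩]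
  simp only [Submodule.coe_sum, Submodule.coe_smul]

omit [Fintype ι] in
/-- A vector orthogonal to all block basis vectors is orthogonal to everything. [folklore] -/
private theorem GluedCasimir.form_eq_zero_of_forall_basis (hint : DirectSum.IsInternal T)
    (b : ∀ i, Module.Basis (Fin 2) K (T i)) (Ψ : LinearMap.BilinForm K W) {y : W}
    (h : ∀ k r, Ψ (b k r : W) y = 0) (x : W) : Ψ x y = 0 := by
  have hx : x ∈ ⨆ k, T k := by rw [hint.submodule_iSup_eq_top]; exact Submodule.mem_top
  induction hx using Submodule.iSup_induction' with
  | mem k x hx =>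
    rw [GluedCasimir.eq_sum_repr b hx, map_sum, LinearMap.sum_apply]
    exact Finset.sum_eq_zero fun c _ => by rw [map_smul, LinearMap.smul_apply, h, smul_zero]
  | zero => simp
  | add x x' _ _ hx hx' => rw [map_add, LinearMap.add_apply, hx, hx', add_zero]

omit [Fintype ι] in
/-- The basis vectors of one kind of the blocks are linearly independent. [folklore] -/
private theorem GluedCasimir.linearIndependent_basis (hint : DirectSum.IsInternal T)
    (b : ∀ i, Module.Basis (Fin 2) K (T i)) (r : Fin 2) :
    LinearIndependent K fun k : ι => (b k r : W) := by
  have h := (hint.collectedBasis b).linearIndependent.comp (fun k : ι => (⟨k, r⟩ : Σ _ : ι, Fin 2))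
    fun _ _ h => congrArg Sigma.fst h
  convert h using 1
  funext k
  simp [DirectSum.IsInternal.collectedBasis_coe]

/-- The two elements of `Fin 2`. [folklore] -/
private theorem GluedCasimir.fin2_eq (r : Fin 2) : r = 0 ∨ r = 1 := by
  fin_cases r <;> simp

/-- **The Gram matrix `Φ(k,k') = Ψ(b_k 0, b_{k'} 1)` of a non-degenerate form with `Ψ(b_k 1, b_{k'} 1) = 0` is
invertible** (a vector `c` with `Φ c = 0` gives `∑ c_{k'} b_{k'} 1 ⊥ W`). [cite: GoodmanWallachGTM255, §4.1.1] -/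
theorem GluedCasimir.isUnit_gram (hint : DirectSum.IsInternal T) (b : ∀ i, Module.Basis (Fin 2) K (T i))
    (Ψ : LinearMap.BilinForm K W) (hΨ : ∀ y, (∀ x, Ψ x y = 0) → y = 0)
    (h11 : ∀ k k', Ψ (b k 1 : W) (b k' 1) = 0) :
    IsUnit (Matrix.of fun k k' : ι => Ψ (b k 0 : W) (b k' 1)) := by
  rw [← Matrix.mulVec_injective_iff_isUnit]
  intro v v' hvv'
  rw [← sub_eq_zero]
  set c : ι → K := v - v' with hc
  have hc0 : (Matrix.of fun k k' : ι => Ψ (b k 0 : W) (b k' 1)).mulVec c = 0 := by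
    rw [hc, Matrix.mulVec_sub, hvv', sub_self]
  set y : W := ∑ k', c k' • (b k' 1 : W) with hy
  have hy0 : y = 0 := by
    refine hΨ y (GluedCasimir.form_eq_zero_of_forall_basis hint b Ψ (fun k r => ?_))
    rcases GluedCasimir.fin2_eq r with rfl | rfl
    · have h := congrFun hc0 k
      rw [Matrix.mulVec, dotProduct, Pi.zero_apply] at h
      rw [hy, map_sum]
      simp only [map_smul, smul_eq_mul, Matrix.of_apply] at h ⊢
      rw [← h]
      exact Finset.sum_congr rfl fun k' _ => mul_comm _ _
    · rw [hy, map_sum]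
      exact Finset.sum_eq_zero fun k' _ => by rw [map_smul, h11, smul_zero]
  rw [hy] at hy0
  funext k'
  exact Fintype.linearIndependent_iff.1 (GluedCasimir.linearIndependent_basis hint b 1) c hy0 k'

/-- **The Casimir contraction in glued block coordinates.** Let `(w, d)` be a reproducing pair for `Ψ`
(`x = ∑_i Ψ(x, w_i) d_i`), `Ψ` non-degenerate, and `b_k` block bases with `Ψ(b_k 0, b_{k'} 0) = Ψ(b_k 1, b_{k'} 1) = 0`,
`Φ(k,k') = Ψ(b_k 0, b_{k'} 1)` symmetric and `Ψ(b_k 1, b_{k'} 0) = -Φ(k',k)`. Then for every operator `Y`,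
`∑_i β(Y d_i, w_i) = ∑_{k,k''} Φ⁻¹(k,k'') (β(Y b_{k''} 0, b_k 1) - β(Y b_{k''} 1, b_k 0))` — the `Ψ`-dual family
of the block basis is `d'_{(k,0)} = -∑_{k''} Φ⁻¹(k,k'') b_{k''} 1`, `d'_{(k,1)} = ∑_{k''} Φ⁻¹(k,k'') b_{k''} 0`
(`sum_dual_eq_sum_dual`). The case of `Ψ`-orthogonal blocks (`Φ` diagonal) is the tree's
`casimirClass_eq_sum_blocks`. [cite: GoodmanWallachGTM255, §4.1.1] [cite: Hazama1983, §3 (p. 305)] -/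
theorem GluedCasimir.sum_dual_eq_sum_blocks (hint : DirectSum.IsInternal T) (b : ∀ i, Module.Basis (Fin 2) K (T i))
    (Ψ : LinearMap.BilinForm K W) (β : W →ₗ[K] W →ₗ[K] P)
    {I : Type*} [Fintype I] (w d : I → W) (hrep : ∀ x, x = ∑ i, Ψ x (w i) • d i)
    (hΨ : ∀ y, (∀ x, Ψ x y = 0) → y = 0)
    (h00 : ∀ k k', Ψ (b k 0 : W) (b k' 0) = 0) (h11 : ∀ k k', Ψ (b k 1 : W) (b k' 1) = 0)
    (hsymm : ∀ k k', Ψ (b k 0 : W) (b k' 1) = Ψ (b k' 0 : W) (b k 1))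
    (halt : ∀ k k', Ψ (b k 1 : W) (b k' 0) = -Ψ (b k' 0 : W) (b k 1)) (Y : Module.End K W) :
    ∑ i, β (Y (d i)) (w i) =
      ∑ k, ∑ k'', (Matrix.of fun k k' : ι => Ψ (b k 0 : W) (b k' 1))⁻¹ k k'' •
        (β (Y (b k'' 0)) (b k 1) - β (Y (b k'' 1)) (b k 0)) := by
  classical
  set Φ : Matrix ι ι K := Matrix.of fun k k' : ι => Ψ (b k 0 : W) (b k' 1) with hΦ
  have hΦapply : ∀ k k', Φ k k' = Ψ (b k 0 : W) (b k' 1) := fun k k' => rfl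
  have hunit : IsUnit Φ.det := (Matrix.isUnit_iff_isUnit_det Φ).1 (GluedCasimir.isUnit_gram hint b Ψ hΨ h11)
  have hPΦ : Φ⁻¹ * Φ = 1 := Matrix.nonsing_inv_mul Φ hunit
  have hΦP : Φ * Φ⁻¹ = 1 := Matrix.mul_nonsing_inv Φ hunit
  have hPΦ' : ∀ k k', ∑ j, Φ⁻¹ k j * Φ j k' = if k = k' then 1 else 0 := fun k k' => by
    rw [← Matrix.mul_apply, hPΦ, Matrix.one_apply]
  -- the block family and its dual family
  set w' : ι × Fin 2 → W := fun kr => b kr.1 kr.2 with hw'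
  set d' : ι × Fin 2 → W := fun kr =>
    if kr.2 = 0 then -∑ k'', Φ⁻¹ kr.1 k'' • (b k'' 1 : W) else ∑ k'', Φ⁻¹ kr.1 k'' • (b k'' 0 : W) with hd'
  have hd'0 : ∀ k, d' (k, 0) = -∑ k'', Φ⁻¹ k k'' • (b k'' 1 : W) := fun k => if_pos rfl
  have hd'1 : ∀ k, d' (k, 1) = ∑ k'', Φ⁻¹ k k'' • (b k'' 0 : W) := fun k => if_neg one_ne_zero
  have hw'r : ∀ k r, w' (k, r) = (b k r : W) := fun k r => rfl
  have hdual : ∀ j l, Ψ (d' j) (w' l) = if l = j then 1 else 0 := by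
    rintro ⟨k, r⟩ ⟨k', r'⟩
    rw [hw'r]
    rcases GluedCasimir.fin2_eq r with rfl | rfl <;> rcases GluedCasimir.fin2_eq r' with rfl | rfl
    · rw [hd'0, map_neg, LinearMap.neg_apply, map_sum, LinearMap.sum_apply]
      simp only [map_smul, LinearMap.smul_apply, smul_eq_mul, halt _ k', ← hΦapply, mul_neg,
        Finset.sum_neg_distrib, neg_neg]
      simp_rw [hΦapply k', hsymm k', ← hΦapply]
      rw [hPΦ' k k']
      by_cases hkk' : k = k'
      · subst hkk'; simp
      · rw [if_neg hkk', if_neg (fun h => hkk' (congrArg Prod.fst h).symm)]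
    · rw [hd'0, map_neg, LinearMap.neg_apply, map_sum, LinearMap.sum_apply, if_neg (by simp)]
      simp only [map_smul, LinearMap.smul_apply, h11, smul_zero, Finset.sum_const_zero, neg_zero]
    · rw [hd'1, map_sum, LinearMap.sum_apply, if_neg (by simp)]
      simp only [map_smul, LinearMap.smul_apply, h00, smul_zero, Finset.sum_const_zero]
    · rw [hd'1, map_sum, LinearMap.sum_apply]
      simp only [map_smul, LinearMap.smul_apply, smul_eq_mul, ← hΦapply]
      rw [hPΦ' k k']
      by_cases hkk' : k = k'
      · subst hkk'; simp
      · rw [if_neg hkk', if_neg (fun h => hkk' (congrArg Prod.fst h).symm)]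
  have hsep : ∀ y, (∀ j, Ψ (d' j) y = 0) → y = 0 := by
    intro y hy
    -- the vectors `(Ψ(b_k 0, y))_k` and `(Ψ(b_k 1, y))_k` are killed by `Φ⁻¹`, hence vanish
    have hv0 : ∀ k'', Ψ (b k'' 0 : W) y = 0 := by
      have hz : Φ⁻¹.mulVec (fun k'' => Ψ (b k'' 0 : W) y) = 0 := by
        funext k
        have h := hy (k, 1)
        rw [hd'1, map_sum, LinearMap.sum_apply] at h
        simp only [map_smul, LinearMap.smul_apply, smul_eq_mul] at h
        rw [Matrix.mulVec, dotProduct, Pi.zero_apply]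
        exact h
      intro k''
      have h := congrFun (congrArg Φ.mulVec hz) k''
      rw [Matrix.mulVec_mulVec, hΦP, Matrix.one_mulVec, Matrix.mulVec_zero, Pi.zero_apply] at h
      exact h
    have hv1 : ∀ k'', Ψ (b k'' 1 : W) y = 0 := by
      have hz : Φ⁻¹.mulVec (fun k'' => Ψ (b k'' 1 : W) y) = 0 := by
        funext k
        have h := hy (k, 0)
        rw [hd'0, map_neg, LinearMap.neg_apply, map_sum, LinearMap.sum_apply, neg_eq_zero] at h
        simp only [map_smul, LinearMap.smul_apply, smul_eq_mul] at h
        rw [Matrix.mulVec, dotProduct, Pi.zero_apply]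
        exact h
      intro k''
      have h := congrFun (congrArg Φ.mulVec hz) k''
      rw [Matrix.mulVec_mulVec, hΦP, Matrix.one_mulVec, Matrix.mulVec_zero, Pi.zero_apply] at h
      exact h
    refine hΨ y (GluedCasimir.form_eq_zero_of_forall_basis hint b Ψ fun k r => ?_)
    rcases GluedCasimir.fin2_eq r with rfl | rfl
    · exact hv0 k
    · exact hv1 k
  rw [sum_dual_eq_sum_dual Ψ β w d hrep w' d' hdual hsep Y, Fintype.sum_prod_type]
  refine Finset.sum_congr rfl fun k _ => ?_
  rw [Fin.sum_univ_two, hw'r, hw'r, hd'0, hd'1, map_neg, map_sum, map_sum, map_neg, map_sum, map_sum,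
    LinearMap.neg_apply, LinearMap.sum_apply, LinearMap.sum_apply, ← Finset.sum_neg_distrib,
    ← Finset.sum_add_distrib]
  refine Finset.sum_congr rfl fun k'' _ => ?_
  rw [map_smul, map_smul, map_smul, map_smul, LinearMap.smul_apply, LinearMap.smul_apply, smul_sub]
  abel

omit [Fintype ι] in
/-- The elementary intertwiner `u_{k₁ k₂}` (`RealPlaces.intertwiner _ _ k₁ k₂ 1`) maps `b_{k₂} r ↦ b_{k₁} r`.
[cite: Hazama1983, §3 (p. 306), Lemma (3.1)] -/
theorem GluedCasimir.intertwiner_one_apply_same (hint : DirectSum.IsInternal T)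
    (b : ∀ i, Module.Basis (Fin 2) K (T i)) (k₁ k₂ : ι) (r : Fin 2) :
    RealPlaces.intertwiner hint b k₁ k₂ 1 (b k₂ r) = (b k₁ r : W) := by
  rw [RealPlaces.intertwiner_apply_same, Fin.sum_univ_two]
  rcases GluedCasimir.fin2_eq r with rfl | rfl
  · rw [Matrix.one_apply_eq, Matrix.one_apply_ne (by decide), one_smul, zero_smul, add_zero]
  · rw [Matrix.one_apply_ne (by decide), Matrix.one_apply_eq, zero_smul, one_smul, zero_add]

/-- **The pairing of two blocks through the Casimir contractions of the elementary intertwiners**: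
`β(b_{k₁} 0, b_{k₃} 1) - β(b_{k₁} 1, b_{k₃} 0) = ∑_{k₂} Φ(k₂, k₃) · ∑_i β(u_{k₁ k₂} d_i, w_i)`
(`u_{k₁ k₂} : b_{k₂} r ↦ b_{k₁} r`; `Φ Φ⁻¹ = 1`). [cite: GoodmanWallachGTM255, §4.1.1] [cite: Hazama1983, §3 (p. 306)] -/
theorem GluedCasimir.pairing_eq_sum_gram_smul (hint : DirectSum.IsInternal T) (b : ∀ i, Module.Basis (Fin 2) K (T i))
    (Ψ : LinearMap.BilinForm K W) (β : W →ₗ[K] W →ₗ[K] P)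
    {I : Type*} [Fintype I] (w d : I → W) (hrep : ∀ x, x = ∑ i, Ψ x (w i) • d i)
    (hΨ : ∀ y, (∀ x, Ψ x y = 0) → y = 0)
    (h00 : ∀ k k', Ψ (b k 0 : W) (b k' 0) = 0) (h11 : ∀ k k', Ψ (b k 1 : W) (b k' 1) = 0)
    (hsymm : ∀ k k', Ψ (b k 0 : W) (b k' 1) = Ψ (b k' 0 : W) (b k 1))
    (halt : ∀ k k', Ψ (b k 1 : W) (b k' 0) = -Ψ (b k' 0 : W) (b k 1)) (k₁ k₃ : ι) :
    β (b k₁ 0 : W) (b k₃ 1) - β (b k₁ 1 : W) (b k₃ 0) =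
      ∑ k₂, Ψ (b k₂ 0 : W) (b k₃ 1) • ∑ i, β (RealPlaces.intertwiner hint b k₁ k₂ 1 (d i)) (w i) := by
  classical
  set Φ : Matrix ι ι K := Matrix.of fun k k' : ι => Ψ (b k 0 : W) (b k' 1) with hΦ
  have hunit : IsUnit Φ.det := (Matrix.isUnit_iff_isUnit_det Φ).1 (GluedCasimir.isUnit_gram hint b Ψ hΨ h11)
  have hPΦ : Φ⁻¹ * Φ = 1 := Matrix.nonsing_inv_mul Φ hunit
  -- the Casimir contraction of `u_{k₁ k₂}` is `∑_k Φ⁻¹(k, k₂) η(k₁, k)`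
  have hu : ∀ k₂ k'' r, RealPlaces.intertwiner hint b k₁ k₂ 1 (b k'' r : W) =
      if k'' = k₂ then (b k₁ r : W) else 0 := by
    intro k₂ k'' r
    by_cases h : k'' = k₂
    · subst h; rw [if_pos rfl, GluedCasimir.intertwiner_one_apply_same]
    · rw [if_neg h, RealPlaces.intertwiner_apply_ne hint b k₁ k₂ h]
  have hcas : ∀ k₂, ∑ i, β (RealPlaces.intertwiner hint b k₁ k₂ 1 (d i)) (w i) =
      ∑ k, Φ⁻¹ k k₂ • (β (b k₁ 0 : W) (b k 1) - β (b k₁ 1 : W) (b k 0)) := by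
    intro k₂
    rw [GluedCasimir.sum_dual_eq_sum_blocks hint b Ψ β w d hrep hΨ h00 h11 hsymm halt]
    refine Finset.sum_congr rfl fun k _ => ?_
    rw [Finset.sum_eq_single k₂]
    · rw [hu, hu, if_pos rfl, if_pos rfl]
    · intro k'' _ hk''
      rw [hu, hu, if_neg hk'', if_neg hk'', LinearMap.map_zero₂, LinearMap.map_zero₂, sub_zero, smul_zero]
    · intro h; exact absurd (Finset.mem_univ k₂) h
  simp_rw [hcas, Finset.smul_sum, smul_smul]
  rw [Finset.sum_comm]
  have hcoef : ∀ k, ∑ k₂, Ψ (b k₂ 0 : W) (b k₃ 1) * Φ⁻¹ k k₂ = if k = k₃ then 1 else 0 := by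
    intro k
    rw [← Matrix.one_apply, ← hPΦ, Matrix.mul_apply]
    exact Finset.sum_congr rfl fun k₂ _ => by rw [mul_comm]; rfl
  simp_rw [← Finset.sum_smul, hcoef, ite_smul, one_smul, zero_smul]
  rw [Finset.sum_ite_eq', if_pos (Finset.mem_univ k₃)]

end Generic

/-! ### §2 Glued blocks of `H¹(A(ℂ); ℚ) ⊗ ℂ`: Gram relations from `Lie Hg`, Casimir classes, the pairing classes -/

section Glued

variable {A : AbelianVariety ℂ} {ι : Type*} [Fintype ι] [DecidableEq ι]
  {T : ι → Submodule ℂ (ℂ ⊗[ℚ] bettiCohomology A.X 1)}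

/-- `H^{1,0}` is `ψ_ℂ`-isotropic (first Hodge–Riemann relation, weight one). [cite: VoisinHodgeI2002, §7.1.2] -/
theorem form_baseChange_eq_zero_of_mem_piece_one_zero (hHD : exists_isReal_hodgeModel)
    (ψ : (BettiUniverse.hodge hHD (AbelianVariety.isSmoothProjective_holds (A := A)) 1).Polarization)
    {x y : ℂ ⊗[ℚ] bettiCohomology A.X 1}
    (hx : x ∈ (BettiUniverse.hodge hHD (AbelianVariety.isSmoothProjective_holds (A := A)) 1).piece 1 0)
    (hy : y ∈ (BettiUniverse.hodge hHD (AbelianVariety.isSmoothProjective_holds (A := A)) 1).piece 1 0) :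
    ψ.form.baseChange ℂ x y = 0 := by
  have e : (((1 : ℕ) : ℤ) - 1) = 0 := by norm_num
  rw [← e] at hx hy
  exact ψ.form_piece_piece (p := 1) (p' := 1) (by norm_num) hx hy

/-- `H^{0,1}` is `ψ_ℂ`-isotropic (first Hodge–Riemann relation, weight one). [cite: VoisinHodgeI2002, §7.1.2] -/
theorem form_baseChange_eq_zero_of_mem_piece_zero_one (hHD : exists_isReal_hodgeModel)
    (ψ : (BettiUniverse.hodge hHD (AbelianVariety.isSmoothProjective_holds (A := A)) 1).Polarization)
    {x y : ℂ ⊗[ℚ] bettiCohomology A.X 1}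
    (hx : x ∈ (BettiUniverse.hodge hHD (AbelianVariety.isSmoothProjective_holds (A := A)) 1).piece 0 1)
    (hy : y ∈ (BettiUniverse.hodge hHD (AbelianVariety.isSmoothProjective_holds (A := A)) 1).piece 0 1) :
    ψ.form.baseChange ℂ x y = 0 := by
  have e : (((1 : ℕ) : ℤ) - 0) = 1 := by norm_num
  rw [← e] at hx hy
  exact ψ.form_piece_piece (p := 0) (p' := 0) (by norm_num) hx hy

/-- The class operator `N` placed on the blocks of the class of `k₀`, on a block basis vector.
[cite: Hazama1983, §3 (p. 306)] -/
theorem assemble_classIndicator_apply_basis (hint : DirectSum.IsInternal T)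
    (b' : ∀ k, Module.Basis (Fin 2) ℂ (T k)) (cls : ι → ι) (k₀ : ι) (N : Matrix (Fin 2) (Fin 2) ℂ)
    (k : ι) (c : Fin 2) :
    RealPlaces.assemble hint b' (fun k => if cls k = cls k₀ then N else 0) (b' k c) =
      if cls k = cls k₀ then ∑ a, N a c • (b' k a : ℂ ⊗[ℚ] bettiCohomology A.X 1) else 0 := by
  rw [RealPlaces.assemble_apply_basis]
  split_ifs with h
  · rfl
  · simp

/-- **Blocks of different classes are `ψ_ℂ`-orthogonal** (`h = diag(1,-1)` placed on the class of `k` lies in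
`Lie Hg ⊗ ℂ`, hence is `ψ_ℂ`-skew, and acts by `±1` on `b'_k r`, by `0` on `b'_{k'} r'`). [cite: Hazama1983, §3 (p. 306)]
[cite: MoonenZarhin1999LowDim, §3 (3.1)] -/
theorem form_baseChange_eq_zero_of_cls_ne [HodgeTensorFacts.{0, 0}] [Module.Finite ℚ (bettiCohomology A.X 1)]
    (hHD : exists_isReal_hodgeModel)
    (ψ : (BettiUniverse.hodge hHD (AbelianVariety.isSmoothProjective_holds (A := A)) 1).Polarization)
    (hint : DirectSum.IsInternal T) (b' : ∀ k, Module.Basis (Fin 2) ℂ (T k)) (cls : ι → ι)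
    (hreach : ∀ (k₀ : ι) (N : Matrix (Fin 2) (Fin 2) ℂ), N.trace = 0 →
      RealPlaces.assemble hint b' (fun k => if cls k = cls k₀ then N else 0) ∈
        (BettiUniverse.hodge hHD (AbelianVariety.isSmoothProjective_holds (A := A)) 1).hodgeLieC)
    {k k' : ι} (hk : cls k ≠ cls k') (r r' : Fin 2) :
    ψ.form.baseChange ℂ (b' k r : ℂ ⊗[ℚ] bettiCohomology A.X 1) (b' k' r') = 0 := by
  set Y := RealPlaces.assemble hint b' (fun k' => if cls k' = cls k then Matrix.diagonal ![(1 : ℂ), -1] else 0)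
    with hY
  have hYmem := hreach k (Matrix.diagonal ![(1 : ℂ), -1]) (by simp)
  have hskew := formBaseChange_skew_of_mem_hodgeLieC ψ hYmem (b' k r : ℂ ⊗[ℚ] bettiCohomology A.X 1) (b' k' r')
  have hYk : Y (b' k r) = (Matrix.diagonal ![(1 : ℂ), -1] r r) • (b' k r : ℂ ⊗[ℚ] bettiCohomology A.X 1) := by
    rw [hY, assemble_classIndicator_apply_basis, if_pos rfl, Fin.sum_univ_two]
    rcases GluedCasimir.fin2_eq r with rfl | rfl
    · rw [Matrix.diagonal_apply_ne _ (by decide : (1 : Fin 2) ≠ 0), zero_smul, add_zero]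
    · rw [Matrix.diagonal_apply_ne _ (by decide : (0 : Fin 2) ≠ 1), zero_smul, zero_add]
  have hYk' : Y (b' k' r') = 0 := by
    rw [hY, assemble_classIndicator_apply_basis, if_neg (Ne.symm hk)]
  rw [← hY, hYk, hYk', map_zero, neg_zero, map_smul, LinearMap.smul_apply, smul_eq_mul, mul_eq_zero] at hskew
  refine hskew.resolve_left ?_
  rcases GluedCasimir.fin2_eq r with rfl | rfl <;> simp [Matrix.diagonal_apply_eq]

/-- **The Gram matrix `Φ(k,k') = ψ_ℂ(b'_k 0, b'_{k'} 1)` is symmetric** (`E₀₁` placed on the class of `k` lies in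
`Lie Hg ⊗ ℂ` and maps `b'_• 1 ↦ b'_• 0` on that class; `ψ_ℂ` is skew for it and alternating; across classes
both sides vanish). [cite: Hazama1983, §3 (p. 306)] [cite: MoonenZarhin1999LowDim, §3 (3.1)] -/
theorem form_baseChange_glued_symm [HodgeTensorFacts.{0, 0}] [Module.Finite ℚ (bettiCohomology A.X 1)]
    (hHD : exists_isReal_hodgeModel)
    (ψ : (BettiUniverse.hodge hHD (AbelianVariety.isSmoothProjective_holds (A := A)) 1).Polarization)
    (hint : DirectSum.IsInternal T) (b' : ∀ k, Module.Basis (Fin 2) ℂ (T k)) (cls : ι → ι)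
    (hreach : ∀ (k₀ : ι) (N : Matrix (Fin 2) (Fin 2) ℂ), N.trace = 0 →
      RealPlaces.assemble hint b' (fun k => if cls k = cls k₀ then N else 0) ∈
        (BettiUniverse.hodge hHD (AbelianVariety.isSmoothProjective_holds (A := A)) 1).hodgeLieC)
    (k k' : ι) :
    ψ.form.baseChange ℂ (b' k 0 : ℂ ⊗[ℚ] bettiCohomology A.X 1) (b' k' 1) =
      ψ.form.baseChange ℂ (b' k' 0 : ℂ ⊗[ℚ] bettiCohomology A.X 1) (b' k 1) := by
  have hodd : Odd (((1 : ℕ) : ℤ)) := ⟨0, by norm_num⟩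
  by_cases hk : cls k = cls k'
  · set Y := RealPlaces.assemble hint b' (fun k' => if cls k' = cls k then Matrix.single 0 1 (1 : ℂ) else 0)
      with hY
    have hYmem := hreach k (Matrix.single 0 1 (1 : ℂ)) (by simp)
    have hY1 : ∀ k'', cls k'' = cls k → Y (b' k'' 1) = (b' k'' 0 : ℂ ⊗[ℚ] bettiCohomology A.X 1) := by
      intro k'' hk''
      rw [hY, assemble_classIndicator_apply_basis, if_pos hk'', Fin.sum_univ_two, Matrix.single_apply_same,
        Matrix.single_apply_of_row_ne (by decide : (0 : Fin 2) ≠ 1) 1 1 (1 : ℂ), one_smul, zero_smul, add_zero]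
    have hskew := formBaseChange_skew_of_mem_hodgeLieC ψ hYmem (b' k 1 : ℂ ⊗[ℚ] bettiCohomology A.X 1) (b' k' 1)
    rw [← hY, hY1 k rfl, hY1 k' hk.symm,
      form_baseChange_swap_of_odd _ hodd ψ (b' k' 0 : ℂ ⊗[ℚ] bettiCohomology A.X 1) (b' k 1), neg_neg] at hskew
    exact hskew
  · rw [form_baseChange_eq_zero_of_cls_ne hHD ψ hint b' cls hreach hk,
      form_baseChange_eq_zero_of_cls_ne hHD ψ hint b' cls hreach (Ne.symm hk)]

/-- **The `ψ`-Casimir class in glued adapted block coordinates**: `Λ(Y) = ∑_{k,k''} Φ⁻¹(k,k'')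
(ρ(Y b'_{k''} 0) ⌣ ρ(b'_k 1) - ρ(Y b'_{k''} 1) ⌣ ρ(b'_k 0))`, `Φ(k,k') = ψ_ℂ(b'_k 0, b'_{k'} 1)` (the glued form of
the tree's `casimirClass_eq_sum_blocks`). [cite: Hazama1983, §3 (p. 305)] [cite: GoodmanWallachGTM255, §4.1.1] -/
theorem casimirClass_eq_sum_glued_blocks [HodgeTensorFacts.{0, 0}] [Module.Finite ℚ (bettiCohomology A.X 1)]
    (hHD : exists_isReal_hodgeModel)
    (ψ : (BettiUniverse.hodge hHD (AbelianVariety.isSmoothProjective_holds (A := A)) 1).Polarization)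
    (hint : DirectSum.IsInternal T) (b' : ∀ k, Module.Basis (Fin 2) ℂ (T k))
    (hb0 : ∀ k, (b' k 0 : ℂ ⊗[ℚ] bettiCohomology A.X 1) ∈
      (BettiUniverse.hodge hHD (AbelianVariety.isSmoothProjective_holds (A := A)) 1).piece 1 0)
    (hb1 : ∀ k, (b' k 1 : ℂ ⊗[ℚ] bettiCohomology A.X 1) ∈
      (BettiUniverse.hodge hHD (AbelianVariety.isSmoothProjective_holds (A := A)) 1).piece 0 1)
    (cls : ι → ι)
    (hreach : ∀ (k₀ : ι) (N : Matrix (Fin 2) (Fin 2) ℂ), N.trace = 0 →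
      RealPlaces.assemble hint b' (fun k => if cls k = cls k₀ then N else 0) ∈
        (BettiUniverse.hodge hHD (AbelianVariety.isSmoothProjective_holds (A := A)) 1).hodgeLieC)
    {κ : Type*} [Fintype κ] [DecidableEq κ] (e : Module.Basis κ ℚ (bettiCohomology A.X 1))
    (Y : Module.End ℂ (ℂ ⊗[ℚ] bettiCohomology A.X 1)) :
    casimirClass A ψ.form ψ.nondegenerate e Y =
      ∑ k, ∑ k'', (Matrix.of fun k k' : ι =>
          ψ.form.baseChange ℂ (b' k 0 : ℂ ⊗[ℚ] bettiCohomology A.X 1) (b' k' 1))⁻¹ k k'' •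
        (cupH1 A (Y (b' k'' 0)) (b' k 1) - cupH1 A (Y (b' k'' 1)) (b' k 0)) := by
  have hodd : Odd (((1 : ℕ) : ℤ)) := ⟨0, by norm_num⟩
  rw [casimirClass_apply]
  exact GluedCasimir.sum_dual_eq_sum_blocks hint b' _ (cupH1 A) _ _
    (eq_sum_formBaseChange_smul_dualBasis ψ.form ψ.nondegenerate e)
    (fun y hy => ψ.eq_zero_of_forall_form_eq_zero' hy)
    (fun k k' => form_baseChange_eq_zero_of_mem_piece_one_zero hHD ψ (hb0 k) (hb0 k'))
    (fun k k' => form_baseChange_eq_zero_of_mem_piece_zero_one hHD ψ (hb1 k) (hb1 k'))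
    (form_baseChange_glued_symm hHD ψ hint b' cls hreach)
    (fun k k' => form_baseChange_swap_of_odd _ hodd ψ (b' k' 0 : ℂ ⊗[ℚ] bettiCohomology A.X 1) (b' k 1)) Y

/-- **The `ψ`-Casimir class of every element of `End_Hdg(H¹) ⊗ ℂ` is a combination of RATIONAL `(1,1)`-classes**
(for `u = a ⊗ 1`: rational by `isRationalClass_casimirClass_baseChange`, of type `(1,1)` by the glued block
formula `casimirClass_eq_sum_glued_blocks` in the ADAPTED bases `b'`, `a ⊗ 1` preserving `H^{1,0}` and
`H^{0,1}`; then linearity). No self-adjointness of `End_Hdg` for `ψ` is used. [cite: Ribet1983, Thm. 0–1]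
[cite: Hazama1983, §3 (pp. 305–306)] [cite: VoisinHodgeI2002, §7.1.1 and §11.3.1] -/
theorem casimirClass_mem_span_rational_oneOne_of_mem_span_endAlg [HodgeTensorFacts.{0, 0}]
    [Module.Finite ℚ (bettiCohomology A.X 1)] (hHD : exists_isReal_hodgeModel)
    (hI : hodgePQ_independent_of_hodgeModel)
    (ψ : (BettiUniverse.hodge hHD (AbelianVariety.isSmoothProjective_holds (A := A)) 1).Polarization)
    (hint : DirectSum.IsInternal T) (b' : ∀ k, Module.Basis (Fin 2) ℂ (T k))
    (hb0 : ∀ k, (b' k 0 : ℂ ⊗[ℚ] bettiCohomology A.X 1) ∈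
      (BettiUniverse.hodge hHD (AbelianVariety.isSmoothProjective_holds (A := A)) 1).piece 1 0)
    (hb1 : ∀ k, (b' k 1 : ℂ ⊗[ℚ] bettiCohomology A.X 1) ∈
      (BettiUniverse.hodge hHD (AbelianVariety.isSmoothProjective_holds (A := A)) 1).piece 0 1)
    (cls : ι → ι)
    (hreach : ∀ (k₀ : ι) (N : Matrix (Fin 2) (Fin 2) ℂ), N.trace = 0 →
      RealPlaces.assemble hint b' (fun k => if cls k = cls k₀ then N else 0) ∈
        (BettiUniverse.hodge hHD (AbelianVariety.isSmoothProjective_holds (A := A)) 1).hodgeLieC)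
    {κ : Type*} [Fintype κ] [DecidableEq κ] (e : Module.Basis κ ℚ (bettiCohomology A.X 1))
    {u : Module.End ℂ (ℂ ⊗[ℚ] bettiCohomology A.X 1)}
    (hu : u ∈ Submodule.span ℂ ((fun a : Module.End ℚ (bettiCohomology A.X 1) => a.baseChange ℂ) ''
      ((BettiUniverse.hodge hHD (AbelianVariety.isSmoothProjective_holds (A := A)) 1).endAlg :
        Set (Module.End ℚ (bettiCohomology A.X 1))))) :
    casimirClass A ψ.form ψ.nondegenerate e u ∈
      Submodule.span ℂ {c : complexBetti A.X 2 | IsRationalClass c ∧ IsOfHodgeType A.dim A.X 2 1 1 c} := by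
  have hX : IsSmoothProjective A.dim A.X := AbelianVariety.isSmoothProjective_holds
  -- Hodge types of pairings of a `(1,0)`- and a `(0,1)`-class
  have hcup := BettiUniverse.cupPreservesHodgeType hHD hI hX
  have h01 : ∀ x y : ℂ ⊗[ℚ] bettiCohomology A.X 1,
      x ∈ (BettiUniverse.hodge hHD (AbelianVariety.isSmoothProjective_holds (A := A)) 1).piece 1 0 →
      y ∈ (BettiUniverse.hodge hHD (AbelianVariety.isSmoothProjective_holds (A := A)) 1).piece 0 1 →
      IsOfHodgeType A.dim A.X 2 1 1 (cupH1 A x y) := by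
    intro x y hx hy
    have h : IsOfHodgeType A.dim A.X 2 (1 + 0) (0 + 1) _ := hcup (rfl : 1 + 1 = 2)
      ((BettiUniverse.mem_hodge_piece_iff hHD hI hX (k := 1) (p := 1) (q := 0) rfl _).1 hx)
      ((BettiUniverse.mem_hodge_piece_iff hHD hI hX (k := 1) (p := 0) (q := 1) rfl _).1 hy)
    rw [cupH1_apply]; exact h
  have h10 : ∀ x y : ℂ ⊗[ℚ] bettiCohomology A.X 1,
      x ∈ (BettiUniverse.hodge hHD (AbelianVariety.isSmoothProjective_holds (A := A)) 1).piece 0 1 →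
      y ∈ (BettiUniverse.hodge hHD (AbelianVariety.isSmoothProjective_holds (A := A)) 1).piece 1 0 →
      IsOfHodgeType A.dim A.X 2 1 1 (cupH1 A x y) := by
    intro x y hx hy
    have h : IsOfHodgeType A.dim A.X 2 (0 + 1) (1 + 0) _ := hcup (rfl : 1 + 1 = 2)
      ((BettiUniverse.mem_hodge_piece_iff hHD hI hX (k := 1) (p := 0) (q := 1) rfl _).1 hx)
      ((BettiUniverse.mem_hodge_piece_iff hHD hI hX (k := 1) (p := 1) (q := 0) rfl _).1 hy)
    rw [cupH1_apply]; exact h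
  obtain ⟨M⟩ := nonempty_hodgeModel_holds hX
  -- `Λ(a ⊗ 1) ∈ S` for `a ∈ End_Hdg`, then linearity
  have hle : Submodule.span ℂ ((fun a : Module.End ℚ (bettiCohomology A.X 1) => a.baseChange ℂ) ''
      ((BettiUniverse.hodge hHD (AbelianVariety.isSmoothProjective_holds (A := A)) 1).endAlg :
        Set (Module.End ℚ (bettiCohomology A.X 1)))) ≤
      (Submodule.span ℂ {c : complexBetti A.X 2 | IsRationalClass c ∧ IsOfHodgeType A.dim A.X 2 1 1 c}).comap
        (casimirClass A ψ.form ψ.nondegenerate e) := by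
    refine Submodule.span_le.2 ?_
    rintro _ ⟨a, ha, rfl⟩
    refine Submodule.subset_span ⟨isRationalClass_casimirClass_baseChange ψ.form ψ.nondegenerate e a, ?_⟩
    rw [casimirClass_eq_sum_glued_blocks hHD ψ hint b' hb0 hb1 cls hreach e]
    refine IsOfHodgeType.sum hX M _ _ fun k _ => IsOfHodgeType.sum hX M _ _ fun k'' _ =>
      IsOfHodgeType.smul (IsOfHodgeType.sub hX ?_ ?_) _
    · exact h01 _ _ (endAlg.baseChange_mem_piece ⟨a, ha⟩ (hb0 k'')) (hb1 k)
    · exact h10 _ _ (endAlg.baseChange_mem_piece ⟨a, ha⟩ (hb1 k'')) (hb0 k)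
  exact hle hu

/-- **The elementary intertwiner `b'_{k₂} r ↦ b'_{k₁} r` between two blocks OF THE SAME CLASS lies in
`End_Hdg(H¹) ⊗ ℂ`**: every `X ∈ Lie Hg` has the same matrix on both blocks (`hglue`), so the intertwiner commutes
with `Lie Hg ⊗ 1 ∋_ℂ Θ` (`RealPlaces.intertwiner_comm`), hence lies in `End_Hdg ⊗ ℂ`
(`ThetaSubalgebra.mem_span_endAlg_of_forall_commute`). Hazama 1983 Lemma (3.1): isomorphic `𝔥`-modules are
linked. [cite: Hazama1983, Lemma (3.1) and §3 (p. 306)] [cite: DeligneMilne1982Tannakian, §6 Thm. 6.20] -/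
theorem intertwiner_one_mem_span_endAlg [HodgeTensorFacts.{0, 0}] [Module.Finite ℚ (bettiCohomology A.X 1)]
    (hHD : exists_isReal_hodgeModel) (hint : DirectSum.IsInternal T) (b' : ∀ k, Module.Basis (Fin 2) ℂ (T k))
    (cls : ι → ι)
    (hT : ∀ X ∈ (BettiUniverse.hodge hHD (AbelianVariety.isSmoothProjective_holds (A := A)) 1).hodgeLie, ∀ k,
      Set.MapsTo (X.baseChange ℂ) (T k) (T k))
    (hglue : ∀ X ∈ (BettiUniverse.hodge hHD (AbelianVariety.isSmoothProjective_holds (A := A)) 1).hodgeLie,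
      ∀ k k', cls k = cls k' →
        RealPlaces.blockMat hint b' (X.baseChange ℂ) k = RealPlaces.blockMat hint b' (X.baseChange ℂ) k')
    {k₁ k₂ : ι} (hk : cls k₁ = cls k₂) :
    RealPlaces.intertwiner hint b' k₁ k₂ 1 ∈
      Submodule.span ℂ ((fun a : Module.End ℚ (bettiCohomology A.X 1) => a.baseChange ℂ) ''
        ((BettiUniverse.hodge hHD (AbelianVariety.isSmoothProjective_holds (A := A)) 1).endAlg :
          Set (Module.End ℚ (bettiCohomology A.X 1)))) := by
  set H := BettiUniverse.hodge hHD (AbelianVariety.isSmoothProjective_holds (A := A)) 1 with hH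
  obtain ⟨Θ, hΘ⟩ := exists_hodgeTheta H
  have hΘC : Θ ∈ spanC H.hodgeLie := H.mem_hodgeLieC_of_forall_piece hΘ
  refine ThetaSubalgebra.mem_span_endAlg_of_forall_commute H H.hodgeLie hΘ hΘC fun X hX => ?_
  exact RealPlaces.intertwiner_comm hint b' k₁ k₂ 1 (hT X hX)
    (by rw [Matrix.mul_one, Matrix.one_mul, hglue X hX k₁ k₂ hk])

/-- **The pairing class of two blocks of the same class lies in `B¹(A) ⊗ ℂ`**: for `cls k₁ = cls k₃`,
`ρ(b'_{k₁} 0) ⌣ ρ(b'_{k₃} 1) - ρ(b'_{k₁} 1) ⌣ ρ(b'_{k₃} 0)` is a `ℂ`-combination of rational `(1,1)`-classes —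
by `GluedCasimir.pairing_eq_sum_gram_smul` it is `∑_{k₂} Φ(k₂,k₃) Λ(u_{k₁ k₂})`, where `Φ(k₂,k₃) = 0` unless
`cls k₂ = cls k₃`, in which case `u_{k₁ k₂} ∈ End_Hdg ⊗ ℂ` and `Λ(u_{k₁ k₂}) ∈ B¹(A) ⊗ ℂ`. (Ribet / Hazama: the
degree-two invariants of `Hg` are divisor classes; here for blocks linked by `End⁰(A) ⊗ ℂ`.)
[cite: Ribet1983, Thm. 0–1] [cite: Hazama1983, Thm. (1.1) and §3 (pp. 305–306)] [cite: Murty1988, Thm. 2 (p. 67)] -/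
theorem pairing_mem_span_rational_oneOne [HodgeTensorFacts.{0, 0}] [Module.Finite ℚ (bettiCohomology A.X 1)]
    (hHD : exists_isReal_hodgeModel) (hI : hodgePQ_independent_of_hodgeModel)
    (ψ : (BettiUniverse.hodge hHD (AbelianVariety.isSmoothProjective_holds (A := A)) 1).Polarization)
    (hint : DirectSum.IsInternal T) (b' : ∀ k, Module.Basis (Fin 2) ℂ (T k))
    (hb0 : ∀ k, (b' k 0 : ℂ ⊗[ℚ] bettiCohomology A.X 1) ∈
      (BettiUniverse.hodge hHD (AbelianVariety.isSmoothProjective_holds (A := A)) 1).piece 1 0)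
    (hb1 : ∀ k, (b' k 1 : ℂ ⊗[ℚ] bettiCohomology A.X 1) ∈
      (BettiUniverse.hodge hHD (AbelianVariety.isSmoothProjective_holds (A := A)) 1).piece 0 1)
    (cls : ι → ι)
    (hT : ∀ X ∈ (BettiUniverse.hodge hHD (AbelianVariety.isSmoothProjective_holds (A := A)) 1).hodgeLie, ∀ k,
      Set.MapsTo (X.baseChange ℂ) (T k) (T k))
    (hreach : ∀ (k₀ : ι) (N : Matrix (Fin 2) (Fin 2) ℂ), N.trace = 0 →
      RealPlaces.assemble hint b' (fun k => if cls k = cls k₀ then N else 0) ∈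
        (BettiUniverse.hodge hHD (AbelianVariety.isSmoothProjective_holds (A := A)) 1).hodgeLieC)
    (hglue : ∀ X ∈ (BettiUniverse.hodge hHD (AbelianVariety.isSmoothProjective_holds (A := A)) 1).hodgeLie,
      ∀ k k', cls k = cls k' →
        RealPlaces.blockMat hint b' (X.baseChange ℂ) k = RealPlaces.blockMat hint b' (X.baseChange ℂ) k')
    {k₁ k₃ : ι} (hk : cls k₁ = cls k₃) :
    cupH1 A (b' k₁ 0 : ℂ ⊗[ℚ] bettiCohomology A.X 1) (b' k₃ 1) -
        cupH1 A (b' k₁ 1 : ℂ ⊗[ℚ] bettiCohomology A.X 1) (b' k₃ 0) ∈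
      Submodule.span ℂ {c : complexBetti A.X 2 | IsRationalClass c ∧ IsOfHodgeType A.dim A.X 2 1 1 c} := by
  classical
  set H := BettiUniverse.hodge hHD (AbelianVariety.isSmoothProjective_holds (A := A)) 1 with hH
  have hodd : Odd (((1 : ℕ) : ℤ)) := ⟨0, by norm_num⟩
  set e := Module.finBasis ℚ (bettiCohomology A.X 1) with he
  rw [GluedCasimir.pairing_eq_sum_gram_smul hint b' _ (cupH1 A) _ _
    (eq_sum_formBaseChange_smul_dualBasis ψ.form ψ.nondegenerate e)
    (fun y hy => ψ.eq_zero_of_forall_form_eq_zero' hy)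
    (fun k k' => form_baseChange_eq_zero_of_mem_piece_one_zero hHD ψ (hb0 k) (hb0 k'))
    (fun k k' => form_baseChange_eq_zero_of_mem_piece_zero_one hHD ψ (hb1 k) (hb1 k'))
    (form_baseChange_glued_symm hHD ψ hint b' cls hreach)
    (fun k k' => form_baseChange_swap_of_odd H hodd ψ (b' k' 0 : ℂ ⊗[ℚ] bettiCohomology A.X 1) (b' k 1)) k₁ k₃]
  refine Submodule.sum_mem _ fun k₂ _ => ?_
  by_cases hk₂ : cls k₂ = cls k₃
  · refine Submodule.smul_mem _ _ ?_
    rw [← casimirClass_apply]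
    exact casimirClass_mem_span_rational_oneOne_of_mem_span_endAlg hHD hI ψ hint b' hb0 hb1 cls hreach e
      (intertwiner_one_mem_span_endAlg hHD hint b' cls hT hglue (hk.trans hk₂.symm))
  · rw [form_baseChange_eq_zero_of_cls_ne hHD ψ hint b' cls hreach hk₂, zero_smul]
    exact Submodule.zero_mem _

/-- **`ρ(b'_k 0) ⌣ ρ(b'_k 1) ∈ B¹(A) ⊗ ℂ`** for glued Hodge-adapted block bases (the case `k₁ = k₃` of
`pairing_mem_span_rational_oneOne`, graded commutativity). The tree's `theta_mem_span_rational_oneOne` is the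
case of `ψ_ℂ`-orthogonal blocks. [cite: Ribet1983, Thm. 0–1] [cite: Hazama1983, §3 (pp. 305–306)] -/
theorem theta_mem_span_rational_oneOne_of_glued [HodgeTensorFacts.{0, 0}]
    [Module.Finite ℚ (bettiCohomology A.X 1)]
    (hHD : exists_isReal_hodgeModel) (hI : hodgePQ_independent_of_hodgeModel)
    (ψ : (BettiUniverse.hodge hHD (AbelianVariety.isSmoothProjective_holds (A := A)) 1).Polarization)
    (hint : DirectSum.IsInternal T) (b' : ∀ k, Module.Basis (Fin 2) ℂ (T k))
    (hb0 : ∀ k, (b' k 0 : ℂ ⊗[ℚ] bettiCohomology A.X 1) ∈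
      (BettiUniverse.hodge hHD (AbelianVariety.isSmoothProjective_holds (A := A)) 1).piece 1 0)
    (hb1 : ∀ k, (b' k 1 : ℂ ⊗[ℚ] bettiCohomology A.X 1) ∈
      (BettiUniverse.hodge hHD (AbelianVariety.isSmoothProjective_holds (A := A)) 1).piece 0 1)
    (cls : ι → ι)
    (hT : ∀ X ∈ (BettiUniverse.hodge hHD (AbelianVariety.isSmoothProjective_holds (A := A)) 1).hodgeLie, ∀ k,
      Set.MapsTo (X.baseChange ℂ) (T k) (T k))
    (hreach : ∀ (k₀ : ι) (N : Matrix (Fin 2) (Fin 2) ℂ), N.trace = 0 →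
      RealPlaces.assemble hint b' (fun k => if cls k = cls k₀ then N else 0) ∈
        (BettiUniverse.hodge hHD (AbelianVariety.isSmoothProjective_holds (A := A)) 1).hodgeLieC)
    (hglue : ∀ X ∈ (BettiUniverse.hodge hHD (AbelianVariety.isSmoothProjective_holds (A := A)) 1).hodgeLie,
      ∀ k k', cls k = cls k' →
        RealPlaces.blockMat hint b' (X.baseChange ℂ) k = RealPlaces.blockMat hint b' (X.baseChange ℂ) k')
    (k : ι) :
    cupH1 A (b' k 0 : ℂ ⊗[ℚ] bettiCohomology A.X 1) (b' k 1) ∈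
      Submodule.span ℂ {c : complexBetti A.X 2 | IsRationalClass c ∧ IsOfHodgeType A.dim A.X 2 1 1 c} := by
  have h := pairing_mem_span_rational_oneOne hHD hI ψ hint b' hb0 hb1 cls hT hreach hglue (rfl : cls k = cls k)
  have hgc : cupH1 A (b' k 1 : ℂ ⊗[ℚ] bettiCohomology A.X 1) (b' k 0) =
      -cupH1 A (b' k 0 : ℂ ⊗[ℚ] bettiCohomology A.X 1) (b' k 1) := by
    rw [cupH1_apply, cupH1_apply, cupProduct_gradedComm_holds ℂ (Motives.ComplexPoints A.X)
      (rfl : 1 + 1 = 2) (rfl : 1 + 1 = 2)]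
    norm_num
  rw [hgc, sub_neg_eq_add, ← two_smul ℂ] at h
  have h2 := Submodule.smul_mem _ (2 : ℂ)⁻¹ h
  rwa [smul_smul, inv_mul_cancel₀ (two_ne_zero), one_smul] at h2

end Glued

/-! ### §3 Crossed classes of two slots at blocks of the same class; evaluation of classwise invariants into `D• ⊗ ℂ` -/

section Slots

variable {A B : AbelianVariety ℂ} {n : ℕ} {ι : Type*} [Fintype ι] [DecidableEq ι]
  {T : ι → Submodule ℂ (ℂ ⊗[ℚ] bettiCohomology A.X 1)}

/-- **Pull-backs along `End⁰(A) ⊗ 1`: `ρ((F^* ⊗ 1) y) = F^* ρ(y)`** (`ρ : H¹(A; ℚ) ⊗ ℂ ≅ H¹(A(ℂ); ℂ)`).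
[cite: VoisinHodgeI2002, §7.1.1] -/
theorem ofRatClassBaseChange_pull_baseChange (F : A ⟶ A) (y : ℂ ⊗[ℚ] bettiCohomology A.X 1) :
    ofRatClassBaseChange (Motives.ComplexPoints A.X) 1 ((BettiUniverse.pull F.hom.hom.hom 1).baseChange ℂ y) =
      complexBetti.map F.hom.hom.hom 1 (ofRatClassBaseChange (Motives.ComplexPoints A.X) 1 y) := by
  have hX : IsSmoothProjective A.dim A.X := AbelianVariety.isSmoothProjective_holds
  have h := complexBetti_map_ofRatClassBaseChangeEquiv hX hX F.hom.hom.hom (k := 1) y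
  rw [ofRatClassBaseChangeEquiv_apply, ofRatClassBaseChangeEquiv_apply] at h
  exact h.symm

/-- `(g ≫ F)^* = g^* ∘ F^*` on `H¹(–(ℂ); ℂ)` for homomorphisms of abelian varieties. [folklore] -/
private theorem complexBetti_map_comp_hom_apply (g : B ⟶ A) (F : A ⟶ A) (x : complexBetti A.X 1) :
    complexBetti.map (g ≫ F).hom.hom.hom 1 x =
      complexBetti.map g.hom.hom.hom 1 (complexBetti.map F.hom.hom.hom 1 x) := by
  change complexBetti.map (g.hom.hom.hom ≫ F.hom.hom.hom) 1 x = _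
  exact complexBetti.map_comp_apply' _ _ _ _

omit [Fintype ι] in
/-- **The crossed class of two slots at two blocks OF THE SAME CLASS lies in `D¹(B) ⊗ ℂ`**:
`g_j^* b'_k 0 ⌣ g_{j'}^* b'_{k'} 1 + g_{j'}^* b'_{k'} 0 ⌣ g_j^* b'_k 1 ∈ B¹(B) ⊗ ℂ` for `cls k = cls k'`. The second
block is the image of the first under the elementary intertwiner `u_{k' k} ∈ End_Hdg(H¹) ⊗ ℂ` (`hu`), a
`ℂ`-combination of the `F^* ⊗ 1`, `F ∈ End(A)` (Riemann, `mem_endAlg_hodge_one_iff_exists_bettiRep`,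
`exists_unop_bettiRep_eq_smul_pull`); for `v = F^* ⊗ 1` the class is the crossed class of the two slots
`g_j`, `g_{j'} ≫ F` at the SAME block `k`, which lies in `D¹(B) ⊗ ℂ` by the tree's
`rmLetters_cross_mem_span_rational_oneOne` (`(g_j + g_{j'}F)^* θ_k - g_j^* θ_k - (g_{j'}F)^* θ_k`,
`θ_k = b'_k 0 ⌣ b'_k 1 ∈ B¹(A) ⊗ ℂ`, `hθ`). [cite: Hazama1983, Thm. (1.1) and §3 (pp. 305–306)]
[cite: Gordon1997, §3 (proof of the Theorem)] [cite: DeligneMilne1982Tannakian, §6 Thm. 6.20] -/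
theorem gluedLetters_cross_mem_span_rational_oneOne [Module.Finite ℚ (bettiCohomology A.X 1)]
    (g : Fin n → (B ⟶ A)) (hHD : exists_isReal_hodgeModel) (hI : hodgePQ_independent_of_hodgeModel)
    (hint : DirectSum.IsInternal T) (b' : ∀ k, Module.Basis (Fin 2) ℂ (T k))
    (hθ : ∀ k, cupH1 A (b' k 0 : ℂ ⊗[ℚ] bettiCohomology A.X 1) (b' k 1) ∈
      Submodule.span ℂ {c : complexBetti A.X 2 | IsRationalClass c ∧ IsOfHodgeType A.dim A.X 2 1 1 c})
    (cls : ι → ι)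
    (hu : ∀ k₁ k₂, cls k₁ = cls k₂ → RealPlaces.intertwiner hint b' k₁ k₂ 1 ∈
      Submodule.span ℂ ((fun a : Module.End ℚ (bettiCohomology A.X 1) => a.baseChange ℂ) ''
        ((BettiUniverse.hodge hHD (AbelianVariety.isSmoothProjective_holds (A := A)) 1).endAlg :
          Set (Module.End ℚ (bettiCohomology A.X 1)))))
    (x₁ x₂ : Fin n × ι) (hx : cls x₁.2 = cls x₂.2) :
    cupProduct (rfl : 1 + 1 = 2) (rmLetters g b' (x₁, 0)) (rmLetters g b' (x₂, 1)) +
        cupProduct (rfl : 1 + 1 = 2) (rmLetters g b' (x₂, 0)) (rmLetters g b' (x₁, 1)) ∈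
      Submodule.span ℂ {c : complexBetti B.X 2 | IsRationalClass c ∧ IsOfHodgeType B.dim B.X 2 1 1 c} := by
  obtain ⟨j, k⟩ := x₁
  obtain ⟨j', k'⟩ := x₂
  dsimp only at hx
  set S := Submodule.span ℂ {c : complexBetti B.X 2 | IsRationalClass c ∧ IsOfHodgeType B.dim B.X 2 1 1 c}
    with hS
  set ρ := ofRatClassBaseChange (Motives.ComplexPoints A.X) 1 with hρ
  -- the class as a function of the operator carrying the block `k` to the block `k'`
  have key : ∀ v ∈ Submodule.span ℂ ((fun a : Module.End ℚ (bettiCohomology A.X 1) => a.baseChange ℂ) ''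
      ((BettiUniverse.hodge hHD (AbelianVariety.isSmoothProjective_holds (A := A)) 1).endAlg :
        Set (Module.End ℚ (bettiCohomology A.X 1)))),
      cupProduct (rfl : 1 + 1 = 2) (complexBetti.map (g j).hom.hom.hom 1 (ρ (b' k 0)))
          (complexBetti.map (g j').hom.hom.hom 1 (ρ (v (b' k 1)))) +
        cupProduct (rfl : 1 + 1 = 2) (complexBetti.map (g j').hom.hom.hom 1 (ρ (v (b' k 0))))
          (complexBetti.map (g j).hom.hom.hom 1 (ρ (b' k 1))) ∈ S := by
    intro v hv
    induction hv using Submodule.span_induction with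
    | mem Z hZ =>
      obtain ⟨a, ha, rfl⟩ := hZ
      obtain ⟨z, hz⟩ := (mem_endAlg_hodge_one_iff_exists_bettiRep hHD hI a).1 ha
      obtain ⟨c, F, hF⟩ := exists_unop_bettiRep_eq_smul_pull z
      rw [hz] at hF
      -- `a ⊗ 1 = c • (F^* ⊗ 1)` and `ρ ∘ (F^* ⊗ 1) = F^* ∘ ρ`
      have hav : ∀ y, ρ (a.baseChange ℂ y) = algebraMap ℚ ℂ c • complexBetti.map F.hom.hom.hom 1 (ρ y) := by
        intro y
        rw [hF, LinearMap.baseChange_smul, LinearMap.smul_apply, ← algebraMap_smul ℂ c, map_smul, hρ,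
          ofRatClassBaseChange_pull_baseChange F y]
      -- the crossed class of the two slots `g_j`, `g_{j'} ≫ F` at the same block `k`
      have hcross := rmLetters_cross_mem_span_rational_oneOne (![g j, g j' ≫ F]) b' hθ ((0 : Fin 2), k)
        ((1 : Fin 2), k) rfl
      have e0 : ∀ r, rmLetters ![g j, g j' ≫ F] b' (((0 : Fin 2), k), r) =
          complexBetti.map (g j).hom.hom.hom 1 (ρ (b' k r)) := fun r => rfl
      have e1 : ∀ r, rmLetters ![g j, g j' ≫ F] b' (((1 : Fin 2), k), r) =
          complexBetti.map (g j').hom.hom.hom 1 (complexBetti.map F.hom.hom.hom 1 (ρ (b' k r))) := fun r => by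
        rw [rmLetters_apply, ← complexBetti_map_comp_hom_apply]
        rfl
      rw [e0, e0, e1, e1] at hcross
      rw [hav, hav]
      simp only [map_smul, LinearMap.smul_apply]
      rw [← smul_add]
      exact S.smul_mem _ hcross
    | zero =>
      have h0 : ρ ((0 : Module.End ℂ (ℂ ⊗[ℚ] bettiCohomology A.X 1)) (b' k 0 : ℂ ⊗[ℚ] bettiCohomology A.X 1)) = 0 := by
        rw [LinearMap.zero_apply, LinearMap.map_zero]
      have h1 : ρ ((0 : Module.End ℂ (ℂ ⊗[ℚ] bettiCohomology A.X 1)) (b' k 1 : ℂ ⊗[ℚ] bettiCohomology A.X 1)) = 0 := by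
        rw [LinearMap.zero_apply, LinearMap.map_zero]
      have h2 : complexBetti.map (g j').hom.hom.hom 1 (0 : complexBetti A.X 1) = 0 := LinearMap.map_zero _
      rw [h0, h1, h2, LinearMap.map_zero₂, LinearMap.map_zero, add_zero]
      exact S.zero_mem
    | add Z Z' _ _ hZ hZ' =>
      simp only [LinearMap.add_apply, map_add]
      convert S.add_mem hZ hZ' using 1
      abel
    | smul c Z _ hZ =>
      simp only [LinearMap.smul_apply, map_smul]
      rw [← smul_add]
      exact S.smul_mem c hZ
  -- apply it to the elementary intertwiner `u_{k' k}`
  have h := key _ (hu k' k hx.symm)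
  rwa [GluedCasimir.intertwiner_one_apply_same, GluedCasimir.intertwiner_one_apply_same] at h

omit [Fintype ι] in
/-- **The evaluation of a pairing tensor MONOCHROMATIC IN THE CLASS on the letters along a slot-and-block word
lies in `Dᵖ(B) ⊗ ℂ`.** [cite: Gordon1997, §3 (proof of the Theorem)] [cite: GoodmanWallachGTM255, Thm. 5.3.3] -/
theorem sum_pairingTensor_smul_gluedLetters_mem [Module.Finite ℚ (bettiCohomology A.X 1)]
    (g : Fin n → (B ⟶ A)) (hHD : exists_isReal_hodgeModel) (hI : hodgePQ_independent_of_hodgeModel)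
    (hint : DirectSum.IsInternal T) (b' : ∀ k, Module.Basis (Fin 2) ℂ (T k))
    (hθ : ∀ k, cupH1 A (b' k 0 : ℂ ⊗[ℚ] bettiCohomology A.X 1) (b' k 1) ∈
      Submodule.span ℂ {c : complexBetti A.X 2 | IsRationalClass c ∧ IsOfHodgeType A.dim A.X 2 1 1 c})
    (cls : ι → ι)
    (hu : ∀ k₁ k₂, cls k₁ = cls k₂ → RealPlaces.intertwiner hint b' k₁ k₂ 1 ∈
      Submodule.span ℂ ((fun a : Module.End ℚ (bettiCohomology A.X 1) => a.baseChange ℂ) ''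
        ((BettiUniverse.hodge hHD (AbelianVariety.isSmoothProjective_holds (A := A)) 1).endAlg :
          Set (Module.End ℚ (bettiCohomology A.X 1)))))
    {p : ℕ} (u : Fin (2 * p) → Fin n × ι) (e : Fin (2 * p) ≃ Fin 2 × Fin p)
    (he : ∀ c, cls (u (e.symm (0, c))).2 = cls (u (e.symm (1, c))).2) :
    ∑ ε : Word 2 (2 * p), pairingTensor ℂ e ε •
        cupPowOneAlt ℂ (Motives.ComplexPoints B.X) (2 * p) (fun t => rmLetters g b' (u t, ε t)) ∈
      divisorClassesSpan B.X B.dim p := by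
  rw [sum_pairingTensor_smul_eq]
  refine Submodule.smul_mem _ _ ?_
  simp only [cupPowOneAlt_apply]
  exact sum_cupPowOne_pairWord_mem_of_columns (rmLetters g b') p _ _ fun c =>
    gluedLetters_cross_mem_span_rational_oneOne g hHD hI hint b' hθ cls hu _ _ (he c)

/-- **A coefficient function killed, slice by slice along slot-and-block words, by `E₀₁` and `h` placed at the
positions of every CLASS evaluates into `Dᵖ(B) ⊗ ℂ`** (every slice is a combination of pairing tensors
monochromatic in the class, the tree's colourwise first fundamental theorem `mem_span_pairingTensor_of_colourwise`
with colour = class, whose evaluations lie in `Dᵖ ⊗ ℂ`). Hazama 1983 §3: the invariants of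
`𝔥 = ⊕ 𝔰𝔩₂` acting diagonally on `V_i ⊕ ⋯ ⊕ V_i` are generated in degree two.
[cite: Hazama1983, Thm. (1.1) and §3 (pp. 305–306)] [cite: GoodmanWallachGTM255, §4.1.1 and Thm. 5.3.3] -/
theorem wordEval_gluedLetters_mem_divisorClassesSpan_of_classwise [Module.Finite ℚ (bettiCohomology A.X 1)]
    (g : Fin n → (B ⟶ A)) (hHD : exists_isReal_hodgeModel) (hI : hodgePQ_independent_of_hodgeModel)
    (hint : DirectSum.IsInternal T) (b' : ∀ k, Module.Basis (Fin 2) ℂ (T k))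
    (hθ : ∀ k, cupH1 A (b' k 0 : ℂ ⊗[ℚ] bettiCohomology A.X 1) (b' k 1) ∈
      Submodule.span ℂ {c : complexBetti A.X 2 | IsRationalClass c ∧ IsOfHodgeType A.dim A.X 2 1 1 c})
    (cls : ι → ι)
    (hu : ∀ k₁ k₂, cls k₁ = cls k₂ → RealPlaces.intertwiner hint b' k₁ k₂ 1 ∈
      Submodule.span ℂ ((fun a : Module.End ℚ (bettiCohomology A.X 1) => a.baseChange ℂ) ''
        ((BettiUniverse.hodge hHD (AbelianVariety.isSmoothProjective_holds (A := A)) 1).endAlg :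
          Set (Module.End ℚ (bettiCohomology A.X 1)))))
    {p : ℕ} {a : (Fin (2 * p) → (Fin n × ι) × Fin 2) → ℂ}
    (hEa : ∀ (U : Fin (2 * p) → Fin n × ι) (c : ι),
      wordDerAt ℂ (colourOp ℂ (fun t => cls (U t).2) c (Matrix.single 0 1 (1 : ℂ))) (wordSlice a U) = 0)
    (hHa : ∀ (U : Fin (2 * p) → Fin n × ι) (c : ι),
      wordDerAt ℂ (colourOp ℂ (fun t => cls (U t).2) c (Matrix.diagonal ![(1 : ℂ), -1])) (wordSlice a U) = 0) :
    wordEval (cupPowOneAlt ℂ (Motives.ComplexPoints B.X) (2 * p)) (rmLetters g b') a ∈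
      divisorClassesSpan B.X B.dim p := by
  classical
  rw [wordEval_eq_sum_wordSlice]
  refine Submodule.sum_mem _ fun U _ => ?_
  have hslice := mem_span_pairingTensor_of_colourwise (K := ℂ) p (fun t => cls (U t).2) (wordSlice a U)
    (hEa U) (hHa U)
  set L : (Word 2 (2 * p) → ℂ) →ₗ[ℂ] complexBetti B.X (2 * p) :=
    Fintype.linearCombination ℂ (fun ε : Word 2 (2 * p) =>
      cupPowOneAlt ℂ (Motives.ComplexPoints B.X) (2 * p) (fun t => rmLetters g b' (U t, ε t))) with hL
  have hLapply : ∀ c' : Word 2 (2 * p) → ℂ, L c' = ∑ ε, c' ε •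
      cupPowOneAlt ℂ (Motives.ComplexPoints B.X) (2 * p) (fun t => rmLetters g b' (U t, ε t)) :=
    fun c' => Fintype.linearCombination_apply ℂ _ c'
  rw [← hLapply]
  have hle : Submodule.span ℂ (Set.range fun e : {e : Fin (2 * p) ≃ Fin 2 × Fin p //
      ∀ c, cls (U (e.symm (0, c))).2 = cls (U (e.symm (1, c))).2} => pairingTensor ℂ e.1) ≤
      (divisorClassesSpan B.X B.dim p).comap L := by
    refine Submodule.span_le.2 ?_
    rintro _ ⟨e, rfl⟩
    change L (pairingTensor ℂ e.1) ∈ divisorClassesSpan B.X B.dim p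
    rw [hLapply]
    exact sum_pairingTensor_smul_gluedLetters_mem g hHD hI hint b' hθ cls hu U e.1 e.2
  exact hle hslice

end Slots

end Literature.AlgebraicGeometry.HodgeTheory

end
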